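import Literature.NumberTheory.NumberFields.CubicFieldDedekindKummer
import HarnessLib

/-!
# Pure cubic fields `ℚ(∛m)`: the primes of degree one above `p ∤ 3m`

Topic `NumberTheory/NumberFields`, sub-namespace `PureCubic`; a specialisation of the tree's
`MonicCubic` files (`CubicFieldExplicit.lean`, `CubicFieldConductor.lean`,
`CubicFieldDedekindKummer.lean`: a cubic field presented by a root of a monic integer cubic,
Dedekind–Kummer above the primes not dividing the conductor exponent) to the PURE cubic
`X³ - m`, `m ∈ ℕ` not a cube, in the vocabulary used by the quantum class-group line of
`Summits/QuantumAdvantage` (a cubic number field `K`, an algebraic integer `θ` with `θ³ = m`,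
prime ideals `P` of `𝓞 K` with `Ideal.absNorm P = p`).

Let `K` be a number field of degree `3`, `θ ∈ 𝓞 K` with `θ³ = m`, `m` not a cube, and `p` a
rational prime with `p ∤ 3m`. Classical facts (Dedekind 1900 for pure cubic fields; Cohen 1993,
§4.8.2 and §6.4; Marcus, Ch. 3, Thm. 27):

* `mul_mem_adjoin`, `exponent_dvd`, `not_dvd_exponent`: `27 m² · 𝓞 K ⊆ ℤ[θ]`
  (`disc(1, θ, θ²) = disc(X³ - m) = -27 m²`), so the conductor exponent of `θ` divides `27 m²`
  and `p ∤ 3m` gives Mathlib's Dedekind–Kummer hypothesis `p ∤ exponent θ`;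
* `isPrime_span_pair`, `absNorm_span_pair` (the CONSTRUCTIVE half): for every integer `r` with
  `r³ ≡ m (mod p)` the ideal `(p, θ - r)` is a prime ideal of norm `p`;
* `exists_eq_span_pair` (the converse): every prime ideal of norm `p` is `(p, θ - r)` for some
  `r < p` with `r³ ≡ m (mod p)`;
* `intCast_eq_of_span_pair_eq` / `injOn_span_pair`: distinct roots give distinct ideals;
* `setOf_isPrime_absNorm_eq`, `ncard_setOf_isPrime_absNorm_eq`: the prime ideals of norm `p`
  are exactly the `(p, θ - r)`, `r < p`, `r³ ≡ m (mod p)`, and their number is the number of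
  cube roots of `m` modulo `p`.

Everything is proved (from Mathlib's `NumberField.Ideal.primesOverSpanEquivMonicFactorsMod`
through the `MonicCubic` API at `a = b = 0`, `c = -m`). NOT here: the primes dividing `3m`
(ramified or dividing the index; they need Dedekind's integral basis of `ℚ(∛(ab²))`), and the
residue degrees `2` and `3`.

## References

* H. Cohen, *A Course in Computational Algebraic Number Theory*, GTM 138, Springer (1993),
  §4.8.2 (Thm. 4.8.13, decomposition of the primes not dividing the index) and §6.4
  (pure cubic fields). [Cohen1993]
* D. A. Marcus, *Number Fields*, 2nd ed., Springer (2018), Ch. 3, Thm. 27. [Marcus2018]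
-/

noncomputable section

open Polynomial Module NumberField Ideal
open scoped NumberField

namespace Literature.NumberTheory.NumberFields

namespace PureCubic

open MonicCubic

variable {K : Type*} [Field K] [NumberField K] {m : ℕ} {θ : 𝓞 K}

/-! ### `X³ - m` as a `MonicCubic.poly` -/

/-- `MonicCubic.polyQ 0 0 (-m) = X³ - m`. [folklore] -/
theorem polyQ_eq_X_pow_sub_C (m : ℕ) : polyQ 0 0 (-(m : ℤ)) = X ^ 3 - C (m : ℚ) := by
  rw [polyQ_eq]
  simp only [Int.cast_zero, map_zero, zero_mul, add_zero, Int.cast_neg, Int.cast_natCast,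
    map_neg, sub_eq_add_neg]

/-- If `m : ℕ` is not a cube then `X³ - m` (as `MonicCubic.polyQ 0 0 (-m)`) is irreducible over `ℚ`
(rational root theorem: a rational root is an integer `y` with `y³ = m`, so `m = |y|³`). [folklore] -/
theorem irreducible_polyQ (hm : ∀ r : ℕ, r ^ 3 ≠ m) : Irreducible (polyQ 0 0 (-(m : ℤ))) := by
  rw [polyQ_eq_X_pow_sub_C]
  refine X_pow_sub_C_irreducible_of_prime Nat.prime_three fun b hb => ?_
  have hint : IsLocalization.IsInteger ℤ b := by
    refine isInteger_of_is_root_of_monic (p := X ^ 3 - C (m : ℤ))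
      (monic_X_pow_sub_C _ three_ne_zero) ?_
    simp [hb]
  obtain ⟨y, hy⟩ := hint
  apply hm y.natAbs
  have h1 : (y : ℚ) ^ 3 = m := by rw [← hb, ← hy]; rfl
  have h2 : y ^ 3 = (m : ℤ) := by exact_mod_cast h1
  rw [← Int.natAbs_pow, h2, Int.natAbs_natCast]

omit [NumberField K] in
/-- An algebraic integer `θ` with `θ³ = m` is a root of `MonicCubic.poly 0 0 (-m)` in `K`.
[folklore] -/
theorem aeval_poly (hθ : θ ^ 3 = (m : 𝓞 K)) : aeval (θ : K) (poly 0 0 (-(m : ℤ))) = 0 := by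
  have h : ((θ : 𝓞 K) : K) ^ 3 = (m : K) := by
    have := congrArg (fun x : 𝓞 K => (x : K)) hθ
    simpa using this
  simp [poly, h]

omit [NumberField K] in
/-- `MonicCubic.thetaInt` of that root is `θ` itself. [folklore] -/
theorem thetaInt_eq (hθ : θ ^ 3 = (m : 𝓞 K)) : thetaInt (aeval_poly hθ) = θ :=
  RingOfIntegers.ext rfl

/-- `MonicCubic.disc 0 0 (-m) = -27 m²` (the discriminant of `X³ - m`). [folklore] -/
theorem disc_eq (m : ℕ) : disc 0 0 (-(m : ℤ)) = -27 * (m : ℤ) ^ 2 := by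
  simp only [disc]; ring

/-! ### The conductor of `ℤ[θ]` contains `27 m²` -/

/-- **`27 m² · x ∈ ℤ[θ]` for every algebraic integer `x`** of the cubic field `K ∋ θ`,
`θ³ = m` not a cube (`disc(1, θ, θ²) = -27 m²` and `disc · 𝓞 K ⊆ ℤ[θ]`).
[cite: Cohen1993, §4.4 and §6.4] -/
theorem mul_mem_adjoin (h3 : finrank ℚ K = 3) (hm : ∀ r : ℕ, r ^ 3 ≠ m)
    (hθ : θ ^ 3 = (m : 𝓞 K)) (x : 𝓞 K) :
    ((27 * m ^ 2 : ℕ) : K) * x ∈ Algebra.adjoin ℤ ({(θ : K)} : Set K) := by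
  have key := disc_mul_mem_adjoin (irreducible_polyQ hm) (aeval_poly hθ) h3 x
  rw [disc_eq] at key
  have hneg := Subalgebra.neg_mem _ key
  convert hneg using 1
  push_cast
  ring

/-- **The conductor exponent of `θ` divides `27 m²`** (Mathlib's `RingOfIntegers.exponent`, the
positive generator of `𝔣_θ ∩ ℤ`). [cite: Cohen1993, §4.4 and §6.4] -/
theorem exponent_dvd (h3 : finrank ℚ K = 3) (hm : ∀ r : ℕ, r ^ 3 ≠ m)
    (hθ : θ ^ 3 = (m : 𝓞 K)) : RingOfIntegers.exponent θ ∣ 27 * m ^ 2 := by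
  have h := MonicCubic.exponent_dvd (aeval_poly hθ) (mul_mem_adjoin h3 hm hθ)
  rwa [thetaInt_eq hθ] at h

/-- **`p ∤ exponent θ` for a prime `p ∤ 3m`**: Mathlib's Dedekind–Kummer hypothesis holds at every
prime not dividing `3m`. [cite: Cohen1993, §4.8.2 Thm. 4.8.13 and §6.4] -/
theorem not_dvd_exponent (h3 : finrank ℚ K = 3) (hm : ∀ r : ℕ, r ^ 3 ≠ m)
    (hθ : θ ^ 3 = (m : 𝓞 K)) {p : ℕ} (hp : p.Prime) (hpm : ¬ p ∣ 3 * m) :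
    ¬ p ∣ RingOfIntegers.exponent θ := by
  intro h
  have h27 : p ∣ 3 ^ 3 * m ^ 2 := by simpa using h.trans (exponent_dvd h3 hm hθ)
  rcases (Nat.Prime.dvd_mul hp).mp h27 with h | h
  · exact hpm ((hp.dvd_of_dvd_pow h).mul_right m)
  · exact hpm ((hp.dvd_of_dvd_pow h).mul_left 3)

/-! ### The constructive half: `(p, θ - r)` is a prime of norm `p` for every cube root `r` of `m` mod `p` -/

section DedekindKummer

variable {p : ℕ}

/-- The reduction of `X³ - m` modulo `p` evaluates to `r³ - m`. [folklore] -/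
theorem eval_polyMod_pure (m : ℕ) (p : ℕ) (r : ZMod p) :
    (polyMod 0 0 (-(m : ℤ)) p).eval r = r ^ 3 - (m : ZMod p) := by
  rw [eval_polyMod]; push_cast; ring

/-- For a cube root `r` of `m` modulo `p ∤ 3m`, the class of `X - r` is one of the monic
irreducible factors of `minpoly_ℤ θ = X³ - m` modulo `p` (Mathlib's `monicFactorsMod θ p`).
[cite: Cohen1993, §4.8.2 Thm. 4.8.13] -/
theorem X_sub_C_mem_monicFactorsMod [Fact p.Prime] (hm : ∀ r : ℕ, r ^ 3 ≠ m)
    (hθ : θ ^ 3 = (m : 𝓞 K)) {r : ℤ} (hr : (r : ZMod p) ^ 3 = (m : ZMod p)) :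
    (X - C r : ℤ[X]).map (Int.castRingHom (ZMod p)) ∈ RingOfIntegers.monicFactorsMod θ p := by
  classical
  have hmin : minpoly ℤ θ = poly 0 0 (-(m : ℤ)) := by
    rw [← thetaInt_eq hθ]; exact minpoly_thetaInt (irreducible_polyQ hm) (aeval_poly hθ)
  have hmap : (X - C r : ℤ[X]).map (Int.castRingHom (ZMod p)) = X - C (r : ZMod p) := by
    rw [Polynomial.map_sub, map_X, map_C, eq_intCast]
  rw [RingOfIntegers.monicFactorsMod, Multiset.mem_toFinset, hmin, hmap]
  change X - C (r : ZMod p) ∈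
    UniqueFactorizationMonoid.normalizedFactors (polyMod 0 0 (-(m : ℤ)) p)
  rw [Polynomial.mem_normalizedFactors_iff (monic_polyMod 0 0 (-(m : ℤ)) p).ne_zero]
  refine ⟨irreducible_X_sub_C _, monic_X_sub_C _, ?_⟩
  rw [dvd_iff_isRoot, IsRoot.def, eval_polyMod_pure, hr, sub_self]

/-- **`(p, θ - r)` is a prime ideal above `p` of residue degree one** for every cube root `r` of
`m` modulo a prime `p ∤ 3m` (the prime that Dedekind–Kummer attaches to the linear factor
`X - r` of `X³ - m (mod p)`). [cite: Cohen1993, §4.8.2 Thm. 4.8.13 and §6.4] -/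
theorem span_pair_mem_primesOver (h3 : finrank ℚ K = 3) (hm : ∀ r : ℕ, r ^ 3 ≠ m)
    (hθ : θ ^ 3 = (m : 𝓞 K)) (hp : p.Prime) (hpm : ¬ p ∣ 3 * m) {r : ℤ}
    (hr : (r : ZMod p) ^ 3 = (m : ZMod p)) :
    span {(p : 𝓞 K), θ - (r : 𝓞 K)} ∈ primesOver (span {(p : ℤ)}) (𝓞 K) ∧
      (span {(p : 𝓞 K), θ - (r : 𝓞 K)}).inertiaDeg ℤ = 1 := by
  haveI := Fact.mk hp
  have hexp := not_dvd_exponent h3 hm hθ hp hpm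
  have hmem := X_sub_C_mem_monicFactorsMod hm hθ hr
  have hspan := NumberField.Ideal.primesOverSpanEquivMonicFactorsMod_symm_apply_eq_span hexp hmem
  have hdeg := NumberField.Ideal.inertiaDeg_primesOverSpanEquivMonicFactorsMod_symm_apply hexp hmem
  have haeval : aeval θ (X - C r : ℤ[X]) = θ - (r : 𝓞 K) := by
    simp only [map_sub, aeval_X, aeval_C, algebraMap_int_eq, Int.coe_castRingHom]
  rw [haeval] at hspan
  rw [hspan, Polynomial.map_sub, map_X, map_C, natDegree_X_sub_C] at hdeg
  exact ⟨hspan ▸ ((NumberField.Ideal.primesOverSpanEquivMonicFactorsMod hexp).symm ⟨_, hmem⟩).prop,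
    hdeg⟩

/-- **`(p, θ - r)` is a prime ideal** for every cube root `r` of `m` modulo a prime `p ∤ 3m`.
[cite: Cohen1993, §6.4] -/
theorem isPrime_span_pair (h3 : finrank ℚ K = 3) (hm : ∀ r : ℕ, r ^ 3 ≠ m)
    (hθ : θ ^ 3 = (m : 𝓞 K)) (hp : p.Prime) (hpm : ¬ p ∣ 3 * m) {r : ℤ}
    (hr : (r : ZMod p) ^ 3 = (m : ZMod p)) : (span {(p : 𝓞 K), θ - (r : 𝓞 K)}).IsPrime :=
  (span_pair_mem_primesOver h3 hm hθ hp hpm hr).1.1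

/-- **`(p, θ - r)` has norm `p`** for every cube root `r` of `m` modulo a prime `p ∤ 3m`.
[cite: Cohen1993, §6.4] -/
theorem absNorm_span_pair (h3 : finrank ℚ K = 3) (hm : ∀ r : ℕ, r ^ 3 ≠ m)
    (hθ : θ ^ 3 = (m : 𝓞 K)) (hp : p.Prime) (hpm : ¬ p ∣ 3 * m) {r : ℤ}
    (hr : (r : ZMod p) ^ 3 = (m : ZMod p)) : absNorm (span {(p : 𝓞 K), θ - (r : 𝓞 K)}) = p := by
  obtain ⟨⟨hP, hover⟩, hdeg⟩ := span_pair_mem_primesOver h3 hm hθ hp hpm hr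
  have h := Ideal.pow_inertiaDeg p (span {(p : 𝓞 K), θ - (r : 𝓞 K)})
  rwa [hdeg, pow_one, eq_comm] at h

/-! ### The converse: every prime of norm `p` is some `(p, θ - r)` -/

/-- A prime ideal of prime norm `p` lies above `p`. [folklore] -/
theorem mem_primesOver_of_absNorm_eq {P : Ideal (𝓞 K)} (hP : P.IsPrime) (hp : p.Prime)
    (hPn : absNorm P = p) : P ∈ primesOver (span {(p : ℤ)}) (𝓞 K) := by
  have hp0 : (span {(p : ℤ)}) ≠ ⊥ := by simp [hp.ne_zero]
  haveI hmax : (span {(p : ℤ)}).IsMaximal :=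
    ((span_singleton_prime (by exact_mod_cast hp.ne_zero)).mpr
      (Nat.prime_iff_prime_int.mp hp)).isMaximal hp0
  refine ⟨hP, ⟨hmax.eq_of_le (Ideal.IsPrime.under ℤ P).ne_top ?_⟩⟩
  rw [span_singleton_le_iff_mem, mem_under, map_natCast, ← hPn]
  exact absNorm_mem P

/-- `(p, θ - r)` only depends on `r` modulo `p`. [folklore] -/
theorem span_pair_eq_of_intCast_eq {r s : ℤ} (h : (r : ZMod p) = (s : ZMod p)) :
    span {(p : 𝓞 K), θ - (r : 𝓞 K)} = span {(p : 𝓞 K), θ - (s : 𝓞 K)} := by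
  rw [ZMod.intCast_eq_intCast_iff_dvd_sub] at h
  obtain ⟨k, hk⟩ := h
  have : (θ : 𝓞 K) - (r : 𝓞 K) = θ - (s : 𝓞 K) + k * (p : 𝓞 K) := by
    have hk' : ((s : ℤ) : 𝓞 K) - ((r : ℤ) : 𝓞 K) = (k : 𝓞 K) * (p : 𝓞 K) := by
      rw [mul_comm]; exact_mod_cast congrArg (fun z : ℤ => (z : 𝓞 K)) hk
    linear_combination hk'
  rw [this, span_pair_add_mul_left]

/-- **Every prime ideal of norm `p ∤ 3m` is `(p, θ - r)` with `r < p`, `r³ ≡ m (mod p)`.**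
[cite: Cohen1993, §4.8.2 Thm. 4.8.13 and §6.4] -/
theorem exists_eq_span_pair (h3 : finrank ℚ K = 3) (hm : ∀ r : ℕ, r ^ 3 ≠ m)
    (hθ : θ ^ 3 = (m : 𝓞 K)) (hp : p.Prime) (hpm : ¬ p ∣ 3 * m) {P : Ideal (𝓞 K)}
    (hP : P.IsPrime) (hPn : absNorm P = p) :
    ∃ r : ℕ, r < p ∧ r ^ 3 ≡ m [MOD p] ∧ P = span {(p : 𝓞 K), θ - (r : 𝓞 K)} := by
  haveI := Fact.mk hp
  have hexp : ¬ p ∣ RingOfIntegers.exponent (thetaInt (aeval_poly hθ)) := by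
    rw [thetaInt_eq hθ]; exact not_dvd_exponent h3 hm hθ hp hpm
  have hover := mem_primesOver_of_absNorm_eq hP hp hPn
  haveI := hover.2
  have hle : p ^ P.inertiaDeg ℤ ≤ p := (Ideal.pow_inertiaDeg p P).trans_le hPn.le
  have hU : p < p ^ 2 := by
    have := hp.two_le
    nlinarith
  obtain ⟨r, hr, hPeq⟩ :=
    eq_span_pair_of_root' (irreducible_polyQ hm) (aeval_poly hθ) hp hexp hover hle hU
  rw [thetaInt_eq hθ] at hPeq
  have hr' : ((r : ZMod p)) ^ 3 = (m : ZMod p) := by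
    have : (r : ZMod p) ^ 3 - (m : ZMod p) = 0 := by
      rw [← eval_polyMod_pure, eval_polyMod]; exact hr
    exact sub_eq_zero.mp this
  refine ⟨(r : ZMod p).val, ZMod.val_lt _, ?_, ?_⟩
  · rw [← ZMod.natCast_eq_natCast_iff, Nat.cast_pow, ZMod.natCast_zmod_val, hr']
  · refine hPeq.trans ?_
    rw [← Int.cast_natCast (R := 𝓞 K) (r : ZMod p).val]
    exact span_pair_eq_of_intCast_eq (by rw [Int.cast_natCast, ZMod.natCast_zmod_val])

/-! ### Distinct roots give distinct ideals; the set and the count of the primes of norm `p` -/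

omit [NumberField K] in
/-- If `(p, θ - r) = (p, θ - s)` is a proper ideal and `p` is prime then `r ≡ s (mod p)`
(`s - r ∈ (p, θ - r) ∩ ℤ = pℤ`). [folklore] -/
theorem intCast_eq_of_span_pair_eq (hp : p.Prime) {r s : ℤ}
    (hne : span {(p : 𝓞 K), θ - (r : 𝓞 K)} ≠ ⊤)
    (h : span {(p : 𝓞 K), θ - (r : 𝓞 K)} = span {(p : 𝓞 K), θ - (s : 𝓞 K)}) :
    (r : ZMod p) = (s : ZMod p) := by
  set I := span {(p : 𝓞 K), θ - (r : 𝓞 K)} with hI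
  have hrs : ((s - r : ℤ) : 𝓞 K) ∈ I := by
    have h1 : θ - (r : 𝓞 K) ∈ I := subset_span (Set.mem_insert_of_mem _ (Set.mem_singleton _))
    have h2 : θ - (s : 𝓞 K) ∈ I := by
      rw [h]; exact subset_span (Set.mem_insert_of_mem _ (Set.mem_singleton _))
    have := I.sub_mem h1 h2
    push_cast
    convert this using 1
    ring
  have hp0 : (span {(p : ℤ)}) ≠ ⊥ := by simp [hp.ne_zero]
  have hmax : (span {(p : ℤ)}).IsMaximal :=
    ((span_singleton_prime (by exact_mod_cast hp.ne_zero)).mpr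
      (Nat.prime_iff_prime_int.mp hp)).isMaximal hp0
  have hunder : I.under ℤ = span {(p : ℤ)} := by
    refine (hmax.eq_of_le (fun htop => hne ?_) ?_).symm
    · rw [eq_top_iff_one] at htop ⊢
      have := (mem_under ℤ I).mp htop
      simpa using this
    · rw [span_singleton_le_iff_mem, mem_under, map_natCast]
      exact subset_span (Set.mem_insert _ _)
  rw [ZMod.intCast_eq_intCast_iff_dvd_sub, ← mem_span_singleton, ← hunder, mem_under]
  exact_mod_cast hrs

/-- **Distinct cube roots of `m` modulo `p` give distinct primes `(p, θ - r)`.**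
[cite: Cohen1993, §4.8.2 Thm. 4.8.13] -/
theorem injOn_span_pair (h3 : finrank ℚ K = 3) (hm : ∀ r : ℕ, r ^ 3 ≠ m)
    (hθ : θ ^ 3 = (m : 𝓞 K)) (hp : p.Prime) (hpm : ¬ p ∣ 3 * m) :
    Set.InjOn (fun r : ℕ => span {(p : 𝓞 K), θ - (r : 𝓞 K)}) {r : ℕ | r < p ∧ r ^ 3 ≡ m [MOD p]} := by
  intro r hr s hs h
  have hr' : ((r : ℤ) : ZMod p) ^ 3 = (m : ZMod p) := by
    rw [Int.cast_natCast, ← Nat.cast_pow, ZMod.natCast_eq_natCast_iff]; exact hr.2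
  have hne : span {(p : 𝓞 K), θ - ((r : ℤ) : 𝓞 K)} ≠ ⊤ := by
    exact (isPrime_span_pair h3 hm hθ hp hpm hr').ne_top
  have h' : span {(p : 𝓞 K), θ - ((r : ℤ) : 𝓞 K)} = span {(p : 𝓞 K), θ - ((s : ℤ) : 𝓞 K)} := by
    simpa only [Int.cast_natCast] using h
  have := intCast_eq_of_span_pair_eq hp hne h'
  rw [Int.cast_natCast, Int.cast_natCast, ZMod.natCast_eq_natCast_iff'] at this
  rwa [Nat.mod_eq_of_lt hr.1, Nat.mod_eq_of_lt hs.1] at this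

/-- **The prime ideals of norm `p ∤ 3m` of a cubic field `K ∋ θ`, `θ³ = m` not a cube, are
exactly the `(p, θ - r)`, `r < p`, `r³ ≡ m (mod p)`.** [cite: Cohen1993, §6.4] -/
theorem setOf_isPrime_absNorm_eq (h3 : finrank ℚ K = 3) (hm : ∀ r : ℕ, r ^ 3 ≠ m)
    (hθ : θ ^ 3 = (m : 𝓞 K)) (hp : p.Prime) (hpm : ¬ p ∣ 3 * m) :
    {P : Ideal (𝓞 K) | P.IsPrime ∧ absNorm P = p} =
      (fun r : ℕ => span {(p : 𝓞 K), θ - (r : 𝓞 K)}) '' {r : ℕ | r < p ∧ r ^ 3 ≡ m [MOD p]} := by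
  ext P
  simp only [Set.mem_setOf_eq, Set.mem_image]
  constructor
  · rintro ⟨hP, hPn⟩
    obtain ⟨r, hr, hrm, rfl⟩ := exists_eq_span_pair h3 hm hθ hp hpm hP hPn
    exact ⟨r, ⟨hr, hrm⟩, rfl⟩
  · rintro ⟨r, ⟨-, hrm⟩, rfl⟩
    have hr' : ((r : ℤ) : ZMod p) ^ 3 = (m : ZMod p) := by
      rw [Int.cast_natCast, ← Nat.cast_pow, ZMod.natCast_eq_natCast_iff]; exact hrm
    have h1 := isPrime_span_pair h3 hm hθ hp hpm hr'
    have h2 := absNorm_span_pair h3 hm hθ hp hpm hr'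
    rw [Int.cast_natCast] at h1 h2
    exact ⟨h1, h2⟩

/-- **The number of prime ideals of norm `p ∤ 3m` is the number of cube roots of `m` modulo `p`**
(so it is `0`, `1` or `3` according as `m` is a cubic non-residue, `p ≡ 2 (mod 3)`, or
`p ≡ 1 (mod 3)` with `m` a cubic residue). [cite: Cohen1993, §6.4] -/
theorem ncard_setOf_isPrime_absNorm_eq (h3 : finrank ℚ K = 3) (hm : ∀ r : ℕ, r ^ 3 ≠ m)
    (hθ : θ ^ 3 = (m : 𝓞 K)) (hp : p.Prime) (hpm : ¬ p ∣ 3 * m) :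
    {P : Ideal (𝓞 K) | P.IsPrime ∧ absNorm P = p}.ncard =
      {r : ℕ | r < p ∧ r ^ 3 ≡ m [MOD p]}.ncard := by
  rw [setOf_isPrime_absNorm_eq h3 hm hθ hp hpm,
    (injOn_span_pair h3 hm hθ hp hpm).ncard_image]

end DedekindKummer

/-! ### From a cube root in `K` to an algebraic integer -/

omit [NumberField K] in
/-- A cube root `α ∈ K` of `m : ℕ` is an algebraic integer `θ` with `θ³ = m` in `𝓞 K` (so the
statements above apply to any cubic `K ∋ α`, `α³ = m`). [folklore] -/
theorem exists_ringOfIntegers_of_cube_eq {α : K} (hα : α ^ 3 = (m : K)) :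
    ∃ θ : 𝓞 K, (θ : K) = α ∧ θ ^ 3 = (m : 𝓞 K) := by
  have hint : IsIntegral ℤ α :=
    ⟨X ^ 3 - C (m : ℤ), monic_X_pow_sub_C _ three_ne_zero, by simp [hα]⟩
  refine ⟨⟨α, hint⟩, rfl, RingOfIntegers.ext ?_⟩
  simpa using hα

end PureCubic

end Literature.NumberTheory.NumberFields

end
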